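import Summits.QuantumFields.YangMills.Theorems.BalabanUVNodesN15KingModelComplexLinkNeumann
import HarnessLib
/-!
# BalabanUVNodes ∕ N15 — THE KING-MODEL RUNG (PART Ϛ-h): COMPLEX GAUGE COVARIANCE — the `GL(n)`-valued gauge group acts on two-sided link fields by
# `(U,V) ↦ (g(x)U(x,μ)g(x+e_μ)⁻¹, g(x+e_μ)V(x,μ)g(x)⁻¹)`, conjugating `M_{U,V} ↦ D_gM_{U,V}D_g⁻¹`: invertibility, determinant, spectrum are GAUGE INVARIANT; PURE COMPLEX GAUGES are
# invertible at EVERY size (the invertibility locus is unbounded — the polydisc window of Ϛ-b∕Ϛ-d is sufficient, not necessary); unitary gauges preserve the window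
# (Track A, DAG node N15 = NE2; FAN-OUT v1.1 §N15 s3 «KING-MODEL RUNG … + what the curved case adds»; count-neutral)
HONEST FRAMING.  Count-neutral (cell `pub-ymgap`, seat `pub-ymgap-dag-n15-e` g43; `--supports stmt-QuantumFields-27247 --as helper` = K3ᴬ, KEY MAP v3).  One finite torus at fixed
spacing; King's `A = 0` model, FINE covariance layer only; nothing of Bałaban's (3.42) ∕ Thm 3.4 for `G(U)` asserted; nothing continuum ∕ ℝ⁴ ∕ OS ∕ Clay; NOT a node discharge.
WHAT IS DECIDED.  [Balaban1985BackgroundPropagators] p.398 l.19 «invariant with respect to gauge transformations of U» and §3.B p.399 l.37–40 (the complexified group `Gᶜ`):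
on the complexified side the gauge group is complexified too.  For `g : T → GL(n,𝕜)` (bondwise `IsUnit (g x)`):
* §1 `blk_kingGaugeMat_mul_mul` (`(D_gMD_h)_{xy} = g(x)M_{xy}h(y)`), `kingGaugeMat_mul` (`D_gD_h = D_{gh}`), `kingGaugeMat_one`, `kingGaugeMat_mul_inv`∕`_inv_mul` (`D_gD_{g⁻¹} = 1`), `isUnit_kingGaugeMat`;
* §2 defs **`cxGaugeFwd K g U`**, **`cxGaugeBwd K g V`** (the two-sided action); `cxGaugeFwd_of_unitary` (= PART Ͱ-a's `kingGaugeAct` for unitary `g`), `cxGaugeBwd_adjoint_of_unitary` (the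
  adjoint slice is preserved by unitary `g`); ★★ **`cxHop_gauge`** (`T_{g·U,g·V} = D_gT_{U,V}D_{g⁻¹}`, NO invertibility needed), ★★ **`cxLapF_gauge`** (`M_{g·U,g·V} = D_gM_{U,V}D_{g⁻¹}`);
* §3 ★★ **`det_cxLapF_gauge`** (det invariant), ★★ **`isUnit_cxLapF_gauge_iff`** (invertibility invariant), ★★ `cxLapF_inv_gauge` (`G_{g·U,g·V} = D_gG_{U,V}D_{g⁻¹}`), `blk_cxLapF_inv_gauge`
  (`(G_{g·U,g·V})_{xy} = g(x)(G_{U,V})_{xy}g(y)⁻¹`), ★★ **`charpoly_cxLapF_gauge`** (the SPECTRUM of Ϛ-g is gauge invariant);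
* §4 PURE COMPLEX GAUGES `(g(x)g(x+e_μ)⁻¹, g(x+e_μ)g(x)⁻¹)`: ★★★ **`isUnit_cxLapF_pureGauge`** — `M` is invertible at EVERY pure `GL(n)` gauge (`c ≥ 0`, `m² > 0`), however large its bond
  norms; ★★ `det_cxLapF_pureGauge` (`= (det lapF)^{|n|}`, King's free value), ★★ `blk_cxLapF_inv_pureGauge` (`(G)_{xy} = G_King(x,y)·g(x)g(y)⁻¹`); ★★★ **`exists_isUnit_cxLapF_norm_gt`** — on a
  torus with a non-trivial direction, for every `R` there is an invertible two-sided field with a bond of norm `> R`: THE INVERTIBILITY LOCUS IS UNBOUNDED (the sharp polydisc of Ϛ-d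
  bounds the worst field of a given size, not every field);
* §5 unitary gauges preserve bond norms (`norm_cxGaugeFwd_of_unitary`, `norm_cxGaugeBwd_of_unitary`; `CStarRing.norm_mem_unitary_mul`) hence the window (`window_gauge_invariant`).
PRIOR TREE ART (by name): Ͱ-a (`kingGaugeMat`, `kingGaugeAct`, `covLapF`, `ext_of_blk`, `det_covLapF_free`, `lapF_det_isUnit`), Ͱ-g (`blk_covLapF_free_inv`), Ͱ-l (`l2_opNorm_of_mem_unitaryGroup_le`),
Ϛ-a (`cxHop`, `cxLapF`, `blk_cxHop`, `cxLapF_free`, `blk_diagonal_const`), Ϛ-b (`isUnit_cxLapF`), Mathlib (`Matrix.charpoly_units_conj`, `Matrix.nonsing_inv_apply_not_isUnit`,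
`CStarRing.norm_mem_unitary_mul`∕`norm_mul_mem_unitary`, `Matrix.isUnit_iff_isUnit_det`).  Dedup (rg at filing): basename 0 files; needles `cxGaugeFwd|cxGaugeBwd|kingGaugeMat_mul\b|cxLapF_gauge|pureGauge`
checked (the `U(1)` "pure gauge" predicate of Ͱ-d `exists_zeroMode_iff_pureGauge` is a different notion∕name).  Locators: [Balaban1985BackgroundPropagators] p.398 l.19, §3.B p.399 l.37–40, Thm 3.4 p.400;
[King1986] (4.4) p.670.  0 `sorry`.
-/

noncomputable section
open scoped BigOperators ComplexConjugate ComplexOrder Matrix.Norms.L2Operator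
open Finset Matrix

namespace Summit.QuantumFields.YangMills.BalabanUVNodes.N15KingModelRung.Covariant

open Literature.MathematicalPhysics.QuantumFieldTheory.LatticeDiamagneticInequality (Hopping blk)
open Literature.MathematicalPhysics.QuantumFieldTheory.Balaban1983to89.B5Prop11Plancherel (Tor unitVec)
open Literature.MathematicalPhysics.QuantumFieldTheory.King1986.Torus (lapF)

variable {d : ℕ} (K : Fin (d + 1) → ℕ) [hK : ∀ μ, NeZero (K μ)]
variable {𝕜 : Type*} [RCLike 𝕜] {n : Type*}

/-! ## §2 (defs first) The `GL(n)` action on two-sided link fields -/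

/-- THE FORWARD ACTION `(g·U)(x,μ) = g(x)·U(x,μ)·g(x+e_μ)⁻¹` of a (not necessarily unitary) gauge transformation on the forward transporters.
[cite: Balaban1985BackgroundPropagators, p.398 l.19, §3.B p.399 l.37–40] -/
def cxGaugeFwd [Fintype n] [DecidableEq n] (g : Tor K → Matrix n n 𝕜) (U : Tor K × Fin (d + 1) → Matrix n n 𝕜) : Tor K × Fin (d + 1) → Matrix n n 𝕜 :=
  fun b => g b.1 * U b * (g (b.1 + unitVec K b.2))⁻¹

/-- THE BACKWARD ACTION `(g·V)(x,μ) = g(x+e_μ)·V(x,μ)·g(x)⁻¹` on the backward transporters. [cite: Balaban1985BackgroundPropagators, p.398 l.19, §3.B p.399 l.37–40] -/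
def cxGaugeBwd [Fintype n] [DecidableEq n] (g : Tor K → Matrix n n 𝕜) (V : Tor K × Fin (d + 1) → Matrix n n 𝕜) : Tor K × Fin (d + 1) → Matrix n n 𝕜 :=
  fun b => g (b.1 + unitVec K b.2) * V b * (g b.1)⁻¹

variable [Fintype n] [DecidableEq n]

/-! ## §1 Block-diagonal algebra -/

omit [DecidableEq n] in
/-- BLOCKS OF A TWO-SIDED CONJUGATE: `(D_gMD_h)_{xy} = g(x)·M_{xy}·h(y)` for arbitrary site fields `g, h`. [folklore] -/
theorem blk_kingGaugeMat_mul_mul (g h : Tor K → Matrix n n 𝕜) (M : Matrix (Tor K × n) (Tor K × n) 𝕜) (x y : Tor K) :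
    blk (kingGaugeMat K g * M * kingGaugeMat K h) x y = g x * blk M x y * h y := by
  classical
  ext i j
  simp only [blk, Matrix.of_apply, Matrix.mul_apply]
  simp only [kingGaugeMat]
  rw [Fintype.sum_prod_type, Finset.sum_eq_single y (fun z _ hz => by simp [hz]) (fun h => absurd (Finset.mem_univ _) h)]
  simp only [if_true]
  refine Finset.sum_congr rfl fun l _ => ?_
  congr 1
  rw [Fintype.sum_prod_type, Finset.sum_eq_single x (fun z _ hz => by simp [Ne.symm hz]) (fun h => absurd (Finset.mem_univ _) h)]
  simp only [if_true]

omit [DecidableEq n] in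
/-- `D_g·D_h = D_{gh}` (pointwise product). [folklore] -/
theorem kingGaugeMat_mul (g h : Tor K → Matrix n n 𝕜) : kingGaugeMat K g * kingGaugeMat K h = kingGaugeMat K (fun x => g x * h x) := by
  ext ⟨x, i⟩ ⟨y, j⟩
  simp only [Matrix.mul_apply, kingGaugeMat]
  rw [Fintype.sum_prod_type]
  by_cases hxy : x = y
  · subst hxy
    rw [Finset.sum_eq_single x (fun z _ hz => by simp [Ne.symm hz]) (fun h => absurd (Finset.mem_univ _) h)]
    simp only [if_true]
  · simp only [hxy, if_false]
    refine Finset.sum_eq_zero fun z _ => Finset.sum_eq_zero fun k _ => ?_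
    by_cases hz : x = z
    · subst hz; simp [hxy]
    · simp [hz]

omit hK [Fintype n] in
/-- `D_1 = 1`. [folklore] -/
theorem kingGaugeMat_one : kingGaugeMat K (fun _ : Tor K => (1 : Matrix n n 𝕜)) = 1 := by
  ext ⟨x, i⟩ ⟨y, j⟩
  simp only [kingGaugeMat, Matrix.one_apply, Prod.mk.injEq]
  by_cases hxy : x = y
  · subst hxy; simp
  · simp [hxy]

/-- `D_g·D_{g⁻¹} = 1` for a pointwise-invertible gauge transformation. [folklore] -/
theorem kingGaugeMat_mul_inv {g : Tor K → Matrix n n 𝕜} (hg : ∀ x, IsUnit (g x)) :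
    kingGaugeMat K g * kingGaugeMat K (fun x => (g x)⁻¹) = 1 := by
  rw [kingGaugeMat_mul]
  have h : (fun x => g x * (g x)⁻¹) = fun _ : Tor K => (1 : Matrix n n 𝕜) := funext fun x =>
    Matrix.mul_nonsing_inv _ ((Matrix.isUnit_iff_isUnit_det _).mp (hg x))
  rw [h, kingGaugeMat_one]

/-- `D_{g⁻¹}·D_g = 1`. [folklore] -/
theorem kingGaugeMat_inv_mul {g : Tor K → Matrix n n 𝕜} (hg : ∀ x, IsUnit (g x)) :
    kingGaugeMat K (fun x => (g x)⁻¹) * kingGaugeMat K g = 1 := by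
  rw [kingGaugeMat_mul]
  have h : (fun x => (g x)⁻¹ * g x) = fun _ : Tor K => (1 : Matrix n n 𝕜) := funext fun x =>
    Matrix.nonsing_inv_mul _ ((Matrix.isUnit_iff_isUnit_det _).mp (hg x))
  rw [h, kingGaugeMat_one]

/-- `D_g` is invertible. [folklore] -/
theorem isUnit_kingGaugeMat {g : Tor K → Matrix n n 𝕜} (hg : ∀ x, IsUnit (g x)) : IsUnit (kingGaugeMat K g) :=
  IsUnit.of_mul_eq_one _ (kingGaugeMat_mul_inv K hg)

/-- `(D_g)⁻¹ = D_{g⁻¹}`. [folklore] -/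
theorem kingGaugeMat_inv_eq {g : Tor K → Matrix n n 𝕜} (hg : ∀ x, IsUnit (g x)) :
    (kingGaugeMat K g)⁻¹ = kingGaugeMat K (fun x => (g x)⁻¹) :=
  Matrix.inv_eq_right_inv (kingGaugeMat_mul_inv K hg)

/-! ## §2 (continued) The action and the conjugation formulas -/

omit hK in
/-- FOR UNITARY `g` THE FORWARD ACTION IS PART Ͱ-a's `kingGaugeAct` (`g(y)⁻¹ = g(y)^*`). [cite: Balaban1985BackgroundPropagators, p.398 l.19] -/
theorem cxGaugeFwd_of_unitary {g : Tor K → Matrix n n 𝕜} (hg : ∀ x, g x ∈ Matrix.unitaryGroup n 𝕜) (U : Tor K × Fin (d + 1) → Matrix n n 𝕜) :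
    cxGaugeFwd K g U = kingGaugeAct K g U := by
  funext b
  unfold cxGaugeFwd kingGaugeAct
  have h1 : (g (b.1 + unitVec K b.2))ᴴ * g (b.1 + unitVec K b.2) = 1 := by
    simpa only [star_eq_conjTranspose] using Matrix.mem_unitaryGroup_iff'.mp (hg _)
  rw [Matrix.inv_eq_left_inv h1]

omit hK in
/-- FOR UNITARY `g` THE BACKWARD ACTION PRESERVES THE ADJOINT SLICE: `g·(Uᴴ) = (g·U)ᴴ` bondwise. [cite: Balaban1985BackgroundPropagators, p.398 l.19] -/
theorem cxGaugeBwd_adjoint_of_unitary {g : Tor K → Matrix n n 𝕜} (hg : ∀ x, g x ∈ Matrix.unitaryGroup n 𝕜) (U : Tor K × Fin (d + 1) → Matrix n n 𝕜) :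
    cxGaugeBwd K g (fun b => (U b)ᴴ) = fun b => (cxGaugeFwd K g U b)ᴴ := by
  funext b
  unfold cxGaugeBwd cxGaugeFwd
  have h1 : ∀ z, (g z)⁻¹ = (g z)ᴴ := fun z => by
    have h2 : (g z)ᴴ * g z = 1 := by simpa only [star_eq_conjTranspose] using Matrix.mem_unitaryGroup_iff'.mp (hg z)
    exact Matrix.inv_eq_left_inv h2
  rw [h1, h1, conjTranspose_mul, conjTranspose_mul, conjTranspose_conjTranspose, Matrix.mul_assoc]

/-- ★★ **GAUGE CONJUGATION OF THE TWO-SIDED HOPPING MATRIX**: `T_{g·U,g·V} = D_g·T_{U,V}·D_{g⁻¹}` (an identity of the action as DEFINED — no invertibility used).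
[cite: Balaban1985BackgroundPropagators, p.398 l.19, §3.B p.399 l.37–40] -/
theorem cxHop_gauge (c : ℝ) (g : Tor K → Matrix n n 𝕜) (U V : Tor K × Fin (d + 1) → Matrix n n 𝕜) :
    cxHop K c (cxGaugeFwd K g U) (cxGaugeBwd K g V) = kingGaugeMat K g * cxHop K c U V * kingGaugeMat K (fun x => (g x)⁻¹) := by
  refine ext_of_blk K fun x y => ?_
  rw [blk_kingGaugeMat_mul_mul, blk_cxHop, blk_cxHop, Matrix.mul_smul, Matrix.smul_mul, Finset.mul_sum, Finset.sum_mul]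
  congr 1
  refine Finset.sum_congr rfl fun μ _ => ?_
  rw [mul_add, add_mul]
  congr 1
  · by_cases h : y = x + unitVec K μ
    · subst h; simp only [if_true, cxGaugeFwd, Matrix.mul_assoc]
    · simp [h]
  · by_cases h : y = x - unitVec K μ
    · subst h; simp only [if_true, cxGaugeBwd, sub_add_cancel, Matrix.mul_assoc]
    · simp [h]

/-- ★★ **GAUGE CONJUGATION OF THE OPERATOR**: `M_{g·U,g·V} = D_g·M_{U,V}·D_{g⁻¹}` for pointwise-invertible `g`. [cite: Balaban1985BackgroundPropagators, p.398 l.19, §3.B p.399 l.37–40] -/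
theorem cxLapF_gauge (c m2 : ℝ) {g : Tor K → Matrix n n 𝕜} (hg : ∀ x, IsUnit (g x)) (U V : Tor K × Fin (d + 1) → Matrix n n 𝕜) :
    cxLapF K c m2 (cxGaugeFwd K g U) (cxGaugeBwd K g V) = kingGaugeMat K g * cxLapF K c m2 U V * kingGaugeMat K (fun x => (g x)⁻¹) := by
  unfold cxLapF
  rw [Matrix.mul_sub, Matrix.sub_mul, cxHop_gauge]
  congr 1
  have hdiag : diagonal (fun _ : Tor K × n => (((m2 + 2 * ((d : ℝ) + 1) * c : ℝ) : 𝕜))) = (((m2 + 2 * ((d : ℝ) + 1) * c : ℝ) : 𝕜)) • (1 : Matrix (Tor K × n) (Tor K × n) 𝕜) := by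
    ext p q
    simp only [diagonal_apply, Matrix.smul_apply, Matrix.one_apply, smul_eq_mul, mul_ite, mul_one, mul_zero]
  rw [hdiag, Matrix.mul_smul, Matrix.mul_one, Matrix.smul_mul, kingGaugeMat_mul_inv K hg]

/-! ## §3 Invariants: determinant, invertibility, inverse, spectrum -/

/-- ★★ **THE DETERMINANT IS GAUGE INVARIANT** under the complexified gauge group. [cite: Balaban1985BackgroundPropagators, p.398 l.19] -/
theorem det_cxLapF_gauge (c m2 : ℝ) {g : Tor K → Matrix n n 𝕜} (hg : ∀ x, IsUnit (g x)) (U V : Tor K × Fin (d + 1) → Matrix n n 𝕜) :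
    (cxLapF K c m2 (cxGaugeFwd K g U) (cxGaugeBwd K g V)).det = (cxLapF K c m2 U V).det := by
  rw [cxLapF_gauge K c m2 hg, det_mul, det_mul, mul_comm ((kingGaugeMat K g).det), mul_assoc, ← det_mul, kingGaugeMat_mul_inv K hg, det_one, mul_one]

/-- ★★ **INVERTIBILITY IS GAUGE INVARIANT**: `M_{g·U,g·V}` is a unit iff `M_{U,V}` is. [cite: Balaban1985BackgroundPropagators, p.398 l.19, Thm 3.4 p.400] -/
theorem isUnit_cxLapF_gauge_iff (c m2 : ℝ) {g : Tor K → Matrix n n 𝕜} (hg : ∀ x, IsUnit (g x)) (U V : Tor K × Fin (d + 1) → Matrix n n 𝕜) :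
    IsUnit (cxLapF K c m2 (cxGaugeFwd K g U) (cxGaugeBwd K g V)) ↔ IsUnit (cxLapF K c m2 U V) := by
  rw [Matrix.isUnit_iff_isUnit_det, Matrix.isUnit_iff_isUnit_det, det_cxLapF_gauge K c m2 hg]

/-- ★★ **THE INVERSE IS GAUGE COVARIANT**: `G_{g·U,g·V} = D_g·G_{U,V}·D_{g⁻¹}` (both sides `0` when `M_{U,V}` is singular). [cite: Balaban1985BackgroundPropagators, p.398 l.19] -/
theorem cxLapF_inv_gauge (c m2 : ℝ) {g : Tor K → Matrix n n 𝕜} (hg : ∀ x, IsUnit (g x)) (U V : Tor K × Fin (d + 1) → Matrix n n 𝕜) :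
    (cxLapF K c m2 (cxGaugeFwd K g U) (cxGaugeBwd K g V))⁻¹ = kingGaugeMat K g * (cxLapF K c m2 U V)⁻¹ * kingGaugeMat K (fun x => (g x)⁻¹) := by
  by_cases hA : IsUnit (cxLapF K c m2 U V).det
  · refine Matrix.inv_eq_left_inv ?_
    rw [cxLapF_gauge K c m2 hg]
    calc kingGaugeMat K g * (cxLapF K c m2 U V)⁻¹ * kingGaugeMat K (fun x => (g x)⁻¹)
          * (kingGaugeMat K g * cxLapF K c m2 U V * kingGaugeMat K (fun x => (g x)⁻¹))
          = kingGaugeMat K g * (cxLapF K c m2 U V)⁻¹ * (kingGaugeMat K (fun x => (g x)⁻¹) * kingGaugeMat K g) * cxLapF K c m2 U V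
              * kingGaugeMat K (fun x => (g x)⁻¹) := by simp only [Matrix.mul_assoc]
      _ = 1 := by
          rw [kingGaugeMat_inv_mul K hg, Matrix.mul_one, Matrix.mul_assoc (kingGaugeMat K g), Matrix.nonsing_inv_mul _ hA, Matrix.mul_one,
            kingGaugeMat_mul_inv K hg]
  · have hA' : ¬ IsUnit (cxLapF K c m2 (cxGaugeFwd K g U) (cxGaugeBwd K g V)).det := by rwa [det_cxLapF_gauge K c m2 hg]
    rw [Matrix.nonsing_inv_apply_not_isUnit _ hA, Matrix.nonsing_inv_apply_not_isUnit _ hA', Matrix.mul_zero, Matrix.zero_mul]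

/-- The BLOCKS of the inverse transform by two-sided conjugation: `(G_{g·U,g·V})_{xy} = g(x)·(G_{U,V})_{xy}·g(y)⁻¹`. [cite: Balaban1985BackgroundPropagators, p.398 l.19] -/
theorem blk_cxLapF_inv_gauge (c m2 : ℝ) {g : Tor K → Matrix n n 𝕜} (hg : ∀ x, IsUnit (g x)) (U V : Tor K × Fin (d + 1) → Matrix n n 𝕜) (x y : Tor K) :
    blk (cxLapF K c m2 (cxGaugeFwd K g U) (cxGaugeBwd K g V))⁻¹ x y = g x * blk (cxLapF K c m2 U V)⁻¹ x y * (g y)⁻¹ := by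
  rw [cxLapF_inv_gauge K c m2 hg, blk_kingGaugeMat_mul_mul]

/-- ★★ **THE CHARACTERISTIC POLYNOMIAL (hence the SPECTRUM of PART Ϛ-g) IS GAUGE INVARIANT**. [cite: Balaban1985BackgroundPropagators, p.398 l.19] -/
theorem charpoly_cxLapF_gauge (c m2 : ℝ) {g : Tor K → Matrix n n 𝕜} (hg : ∀ x, IsUnit (g x)) (U V : Tor K × Fin (d + 1) → Matrix n n 𝕜) :
    (cxLapF K c m2 (cxGaugeFwd K g U) (cxGaugeBwd K g V)).charpoly = (cxLapF K c m2 U V).charpoly := by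
  rw [cxLapF_gauge K c m2 hg, ← kingGaugeMat_inv_eq K hg]
  have h := Matrix.charpoly_units_conj (isUnit_kingGaugeMat K hg).unit (cxLapF K c m2 U V)
  rwa [(isUnit_kingGaugeMat K hg).unit_spec] at h

/-! ## §4 Pure complex gauges -/

/-- ★★★ **EVERY PURE COMPLEX GAUGE IS INVERTIBLE**: for `c ≥ 0`, `m² > 0` and ANY pointwise-invertible `g : T → GL(n,𝕜)`, the two-sided field
`(g(x)g(x+e_μ)⁻¹, g(x+e_μ)g(x)⁻¹)` — the gauge transform of the free field, of ARBITRARY bond norms — has `M` invertible (`M = D_g·M_1·D_{g⁻¹}`).  The polydisc window of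
PARTS Ϛ-b∕Ϛ-d bounds the WORST field of a given size; along complex gauge orbits the invertibility locus is unbounded. [cite: Balaban1985BackgroundPropagators, §3.B p.399 l.37–40, Thm 3.4 p.400] -/
theorem isUnit_cxLapF_pureGauge {c m2 : ℝ} (hc : 0 ≤ c) (hm : 0 < m2) {g : Tor K → Matrix n n 𝕜} (hg : ∀ x, IsUnit (g x)) :
    IsUnit (cxLapF K c m2 (cxGaugeFwd K g Hopping.free) (cxGaugeBwd K g Hopping.free)) := by
  rw [isUnit_cxLapF_gauge_iff K c m2 hg, cxLapF_free]
  exact isUnit_covLapF K hc hm (free_mem_unitaryGroup K)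

/-- ★★ THE DETERMINANT AT A PURE COMPLEX GAUGE IS KING's FREE VALUE `(det lapF)^{|n|}`. [cite: King1986, (3.89) p.668, (4.4) p.670] -/
theorem det_cxLapF_pureGauge (c m2 : ℝ) {g : Tor K → Matrix n n 𝕜} (hg : ∀ x, IsUnit (g x)) :
    (cxLapF K c m2 (cxGaugeFwd K g Hopping.free) (cxGaugeBwd K g Hopping.free)).det = (((lapF K c m2).det : ℝ) : 𝕜) ^ Fintype.card n := by
  rw [det_cxLapF_gauge K c m2 hg, cxLapF_free, det_covLapF_free]

/-- ★★ THE COVARIANCE AT A PURE COMPLEX GAUGE: `(G)_{xy} = G_King(x,y)·g(x)g(y)⁻¹` — King's `A = 0` kernel times the (non-unitary) parallel transport (`c ≥ 0`, `m² > 0`).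
[cite: King1986, (4.4) p.670; Balaban1985BackgroundPropagators, p.398 l.19] -/
theorem blk_cxLapF_inv_pureGauge {c m2 : ℝ} (hc : 0 ≤ c) (hm : 0 < m2) {g : Tor K → Matrix n n 𝕜} (hg : ∀ x, IsUnit (g x)) (x y : Tor K) :
    blk (cxLapF K c m2 (cxGaugeFwd K g Hopping.free) (cxGaugeBwd K g Hopping.free))⁻¹ x y = (((lapF K c m2)⁻¹ x y : ℝ) : 𝕜) • (g x * (g y)⁻¹) := by
  rw [blk_cxLapF_inv_gauge K c m2 hg, cxLapF_free, blk_covLapF_free_inv K hc hm, Matrix.mul_smul, Matrix.mul_one, Matrix.smul_mul]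

omit hK in
/-- The single-site dilation gauge `g_{x₀,a}(x) = a·1` at `x = x₀`, `1` elsewhere, is pointwise invertible (`a ≠ 0`). [folklore] -/
theorem isUnit_siteDilation (x₀ : Tor K) {a : 𝕜} (ha : a ≠ 0) (x : Tor K) :
    IsUnit ((fun z : Tor K => if z = x₀ then a • (1 : Matrix n n 𝕜) else 1) x) := by
  by_cases hx : x = x₀
  · simp only [hx, if_true]
    refine IsUnit.of_mul_eq_one (a⁻¹ • (1 : Matrix n n 𝕜)) ?_
    rw [smul_mul_smul_comm, Matrix.mul_one, mul_inv_cancel₀ ha, one_smul]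
  · simp only [hx, if_false]; exact isUnit_one

/-- ★★★ **THE INVERTIBILITY LOCUS IS UNBOUNDED**: on a torus with a direction `μ` of period `≥ 2` (`e_μ ≠ 0`), nonempty fibre, `c ≥ 0`, `m² > 0`: for every `R` there is a
two-sided link field with SOME bond of norm `> R` and `M_{U,V}` INVERTIBLE (the pure gauge of a single-site dilation).  So the sharp polydisc of PART Ϛ-d is the largest
`GL`-blind window, not the invertibility locus. [cite: Balaban1985BackgroundPropagators, §3.B p.399 l.37–40, Thm 3.4 p.400] -/
theorem exists_isUnit_cxLapF_norm_gt [Nonempty n] {c m2 : ℝ} (hc : 0 ≤ c) (hm : 0 < m2) (μ : Fin (d + 1)) (hμ : unitVec K μ ≠ 0) (R : ℝ) :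
    ∃ U V : Tor K × Fin (d + 1) → Matrix n n 𝕜, (∃ b, R < ‖U b‖) ∧ IsUnit (cxLapF K c m2 U V) := by
  set a : ℝ := |R| + 1 with ha_def
  have ha0 : 0 < a := by positivity
  have ha' : ((a : 𝕜)) ≠ 0 := by rw [Ne, RCLike.ofReal_eq_zero]; exact ha0.ne'
  set g : Tor K → Matrix n n 𝕜 := fun z => if z = 0 then ((a : 𝕜)) • (1 : Matrix n n 𝕜) else 1 with hg_def
  have hg : ∀ x, IsUnit (g x) := isUnit_siteDilation K 0 ha'
  refine ⟨cxGaugeFwd K g Hopping.free, cxGaugeBwd K g Hopping.free, ⟨((0 : Tor K), μ), ?_⟩, isUnit_cxLapF_pureGauge K hc hm hg⟩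
  have hU : cxGaugeFwd K g Hopping.free ((0 : Tor K), μ) = ((a : 𝕜)) • (1 : Matrix n n 𝕜) := by
    unfold cxGaugeFwd
    have h0 : g 0 = ((a : 𝕜)) • (1 : Matrix n n 𝕜) := by simp [hg_def]
    have h1 : g ((0 : Tor K) + unitVec K μ) = 1 := by
      rw [zero_add]; simp [hg_def, hμ]
    simp only [Hopping.free]
    rw [h0, h1, inv_one, Matrix.mul_one, Matrix.mul_one]
  rw [hU, norm_smul, RCLike.norm_ofReal, norm_one, mul_one, abs_of_pos ha0, ha_def]
  have := le_abs_self R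
  linarith

/-! ## §5 Unitary gauge transformations preserve the window -/

omit hK in
/-- Unitary gauge transformations preserve bond norms (forward): `‖(g·U)(b)‖ = ‖U(b)‖`. [folklore] -/
theorem norm_cxGaugeFwd_of_unitary {g : Tor K → Matrix n n 𝕜} (hg : ∀ x, g x ∈ Matrix.unitaryGroup n 𝕜) (U : Tor K × Fin (d + 1) → Matrix n n 𝕜)
    (b : Tor K × Fin (d + 1)) : ‖cxGaugeFwd K g U b‖ = ‖U b‖ := by
  unfold cxGaugeFwd
  have h1 : (g (b.1 + unitVec K b.2))⁻¹ ∈ Matrix.unitaryGroup n 𝕜 := by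
    have h2 : (g (b.1 + unitVec K b.2))ᴴ * g (b.1 + unitVec K b.2) = 1 := by
      simpa only [star_eq_conjTranspose] using Matrix.mem_unitaryGroup_iff'.mp (hg _)
    rw [Matrix.inv_eq_left_inv h2]
    simpa only [star_eq_conjTranspose] using Unitary.star_mem (hg _)
  rw [CStarRing.norm_mul_mem_unitary _ h1, CStarRing.norm_mem_unitary_mul _ (hg _)]

omit hK in
/-- Unitary gauge transformations preserve bond norms (backward): `‖(g·V)(b)‖ = ‖V(b)‖`. [folklore] -/
theorem norm_cxGaugeBwd_of_unitary {g : Tor K → Matrix n n 𝕜} (hg : ∀ x, g x ∈ Matrix.unitaryGroup n 𝕜) (V : Tor K × Fin (d + 1) → Matrix n n 𝕜)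
    (b : Tor K × Fin (d + 1)) : ‖cxGaugeBwd K g V b‖ = ‖V b‖ := by
  unfold cxGaugeBwd
  have h1 : (g b.1)⁻¹ ∈ Matrix.unitaryGroup n 𝕜 := by
    have h2 : (g b.1)ᴴ * g b.1 = 1 := by
      simpa only [star_eq_conjTranspose] using Matrix.mem_unitaryGroup_iff'.mp (hg _)
    rw [Matrix.inv_eq_left_inv h2]
    simpa only [star_eq_conjTranspose] using Unitary.star_mem (hg _)
  rw [CStarRing.norm_mul_mem_unitary _ h1, CStarRing.norm_mem_unitary_mul _ (hg _)]

omit hK in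
/-- ★ **THE WINDOW IS INVARIANT UNDER UNITARY GAUGE TRANSFORMATIONS** (and, by §3, so are all the conclusions of PARTS Ϛ-b–Ϛ-g up to conjugation of the blocks).
[cite: Balaban1985BackgroundPropagators, p.398 l.19, Thm 3.4 p.400] -/
theorem window_gauge_invariant {ε : ℝ} {g : Tor K → Matrix n n 𝕜} (hg : ∀ x, g x ∈ Matrix.unitaryGroup n 𝕜) {U V : Tor K × Fin (d + 1) → Matrix n n 𝕜}
    (hU : ∀ b, ‖U b‖ ≤ 1 + ε) (hV : ∀ b, ‖V b‖ ≤ 1 + ε) :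
    (∀ b, ‖cxGaugeFwd K g U b‖ ≤ 1 + ε) ∧ (∀ b, ‖cxGaugeBwd K g V b‖ ≤ 1 + ε) :=
  ⟨fun b => by rw [norm_cxGaugeFwd_of_unitary K hg]; exact hU b, fun b => by rw [norm_cxGaugeBwd_of_unitary K hg]; exact hV b⟩

end Summit.QuantumFields.YangMills.BalabanUVNodes.N15KingModelRung.Covariant

end
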